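import Literature.Geometry.Lorentzian.KerrSchildDerivativeDecay
import Literature.Geometry.Lorentzian.KerrHyperboloidalLeaves
import Mathlib.Analysis.Calculus.MeanValue
import HarnessLib

/-!
# K2b-5 `stub_marchingLemma`, brick 15: the Kerr–Schild radius is `2`-Lipschitz on short segments of
# the slice — line `direct-method-on-the-cone` (crux `BondiBartnikRigidity`, stmt-FinalStateConjecture-10807)

`radius_sub_le_of_segment`: for `y, y' ∈ E3` with `2 ‖y' − y‖ < r(y) − |a|` one has
`|r(y') − r(y)| ≤ 2 ‖y' − y‖` (and `r > |a|` along the segment).  Used by the covering lemma of the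
marching ("a point of `W ∩ {τ ≤ t* < τ + h}` off the kite is `2h`-close to the roof", report K2b-a2 §4).
Proof: continuous induction along the segment (`IsClosed.Icc_subset_of_forall_mem_nhdsWithin`) with the
gradient bound `‖∇r‖ ≤ 1 + |a|/r ≤ 2` where `r ≥ |a|` (`Kerr.norm_radiusGrad_le_radius`) and the mean
value inequality on subsegments.

References: Visser arXiv:0706.0622, (35) [arXiv07060622]; Dafermos–Rodnianski arXiv:0811.0354, §5.1
[DafermosRodnianski2008].  No definitions, no named facts.
-/

noncomputable section

-- D-0017: single-problem summit, `Summit.<S>.<S>.…` by design (cf. lakefile `weak.linter.dupNamespace`).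
set_option linter.dupNamespace false

open Set Filter Function Topology Metric
open Literature.Geometry.Lorentzian
open scoped Topology

namespace Summit.FinalStateConjecture.FinalStateConjecture.Theorems.BondiBartnikRigidity.DirectMethod

namespace RadiusK

/-- Gradient bound `‖∇r‖ ≤ 2` at slice points with `r ≥ |a|`, `r > 0`. [cite: arXiv07060622, (35)] -/
theorem norm_radiusGrad_le_two {a : ℝ} {y : E3} (hr : 0 < Kerr.radius a (E4.ofTimeSpace 0 y))
    (har : |a| ≤ Kerr.radius a (E4.ofTimeSpace 0 y)) : ‖Kerr.radiusGrad a y‖ ≤ 2 := by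
  refine (Kerr.norm_radiusGrad_le_radius hr).trans ?_
  have : |a| / Kerr.radius a (E4.ofTimeSpace 0 y) ≤ 1 := by rw [div_le_one hr]; exact har
  linarith

/-- **`r` is `2`-Lipschitz along short slice segments**: if `2 ‖y' − y‖ < r(y) − |a|` then for every point
`y + μ (y' − y)`, `μ ∈ [0, 1]`, of the segment, `|r(y + μ(y' − y)) − r(y)| ≤ 2 μ ‖y' − y‖`.
[cite: DafermosRodnianski2008, §5.1] -/
theorem abs_radius_segment_sub_le {a : ℝ} {y y' : E3}
    (h : 2 * ‖y' - y‖ < Kerr.radius a (E4.ofTimeSpace 0 y) - |a|) :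
    ∀ μ ∈ Icc (0 : ℝ) 1, |Kerr.radius a (E4.ofTimeSpace 0 (y + μ • (y' - y))) - Kerr.radius a (E4.ofTimeSpace 0 y)| ≤
      2 * μ * ‖y' - y‖ := by
  set v : E3 := y' - y with hv
  set g : ℝ → ℝ := fun μ => Kerr.radius a (E4.ofTimeSpace 0 (y + μ • v)) with hg
  have hg0 : g 0 = Kerr.radius a (E4.ofTimeSpace 0 y) := by simp [hg]
  have hline : ∀ μ, HasDerivAt (fun μ : ℝ => y + μ • v) v μ := fun μ => by
    simpa using ((hasDerivAt_id μ).smul_const v).const_add y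
  have hgc : Continuous g :=
    ((Kerr.continuous_radius a).comp (E4.continuous_ofTimeSpace 0)).comp
      (continuous_const.add (continuous_id.smul continuous_const))
  -- derivative of `g` where `r > 0`, with the bound `|g'| ≤ 2 ‖v‖` where moreover `r ≥ |a|`
  have hderiv : ∀ μ, 0 < g μ → |a| ≤ g μ → HasDerivAt g (Kerr.radiusGrad a (y + μ • v) v) μ ∧
      |Kerr.radiusGrad a (y + μ • v) v| ≤ 2 * ‖v‖ := by
    intro μ hpos har
    have hF := Kerr.hasFDerivAt_radius_slice (a := a) (y := y + μ • v) hpos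
    refine ⟨?_, ?_⟩
    · have := hF.comp_hasDerivAt μ (hline μ)
      exact this
    calc |Kerr.radiusGrad a (y + μ • v) v| ≤ ‖Kerr.radiusGrad a (y + μ • v)‖ * ‖v‖ := by
          rw [← Real.norm_eq_abs]; exact ContinuousLinearMap.le_opNorm _ _
      _ ≤ 2 * ‖v‖ := mul_le_mul_of_nonneg_right (norm_radiusGrad_le_two hpos har) (norm_nonneg _)
  -- continuous induction
  set S : Set ℝ := {μ | |g μ - g 0| ≤ 2 * μ * ‖v‖} with hS
  suffices hsub : Icc (0 : ℝ) 1 ⊆ S from fun μ hμ => by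
    have h1 : |g μ - g 0| ≤ 2 * μ * ‖v‖ := hsub hμ
    rwa [hg0] at h1
  have hSc : IsClosed S := isClosed_le (continuous_abs.comp (hgc.sub continuous_const))
    ((continuous_const.mul continuous_id).mul continuous_const)
  refine IsClosed.Icc_subset_of_forall_mem_nhdsWithin (hSc.inter isClosed_Icc) (by simp [hS]) ?_
  rintro μ ⟨hμS, hμ0, hμ1⟩
  have hμS' : |g μ - g 0| ≤ 2 * μ * ‖v‖ := hμS
  -- at `μ`: `g μ > |a| + 2 (1 - μ) ‖v‖ ≥ |a|`
  have hgμ : |a| + 2 * (1 - μ) * ‖v‖ < g μ := by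
    have := neg_abs_le (g μ - g 0)
    rw [hg0] at hμS' this
    nlinarith [norm_nonneg v]
  have hvn := norm_nonneg v
  have hgμa : |a| < g μ := by nlinarith
  have hgμ0 : 0 < g μ := lt_of_le_of_lt (abs_nonneg a) hgμa
  -- a neighbourhood where `g > |a|`
  obtain ⟨δ, hδ, hδlt⟩ := Metric.eventually_nhds_iff.1 (hgc.continuousAt.preimage_mem_nhds (Ioi_mem_nhds hgμa))
  have hm : μ < min (μ + δ) 1 := lt_min (by linarith) hμ1
  filter_upwards [Ioo_mem_nhdsGT hm] with t ht
  have htδ : t < μ + δ := ht.2.trans_le (min_le_left _ _)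
  have hgood : ∀ ξ ∈ Icc μ t, |a| < g ξ := fun ξ hξ =>
    hδlt (by rw [Real.dist_eq, abs_lt]; constructor <;> linarith [hξ.1, hξ.2])
  -- mean value inequality on `[μ, t]`
  have hmvt : ‖g t - g μ‖ ≤ 2 * ‖v‖ * (t - μ) := by
    refine norm_image_sub_le_of_norm_deriv_le_segment' (f := g) (f' := fun ξ => Kerr.radiusGrad a (y + ξ • v) v)
      (fun ξ hξ => ?_) (fun ξ hξ => ?_) t (right_mem_Icc.2 ht.1.le)
    · have hξ' : |a| < g ξ := hgood ξ hξ
      exact ((hderiv ξ (lt_of_le_of_lt (abs_nonneg a) hξ') hξ'.le).1).hasDerivWithinAt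
    · have hξ' : |a| < g ξ := hgood ξ (Ico_subset_Icc_self hξ)
      rw [Real.norm_eq_abs]
      exact (hderiv ξ (lt_of_le_of_lt (abs_nonneg a) hξ') hξ'.le).2
  show |g t - g 0| ≤ 2 * t * ‖v‖
  rw [Real.norm_eq_abs] at hmvt
  calc |g t - g 0| = |(g t - g μ) + (g μ - g 0)| := by ring_nf
    _ ≤ |g t - g μ| + |g μ - g 0| := abs_add_le _ _
    _ ≤ 2 * ‖v‖ * (t - μ) + 2 * μ * ‖v‖ := add_le_add hmvt hμS'
    _ = 2 * t * ‖v‖ := by ring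

/-- **Corollary**: `|r(y') − r(y)| ≤ 2 ‖y' − y‖` whenever `2 ‖y' − y‖ < r(y) − |a|`.
[cite: DafermosRodnianski2008, §5.1] -/
theorem abs_radius_sub_le {a : ℝ} {y y' : E3} (h : 2 * ‖y' - y‖ < Kerr.radius a (E4.ofTimeSpace 0 y) - |a|) :
    |Kerr.radius a (E4.ofTimeSpace 0 y') - Kerr.radius a (E4.ofTimeSpace 0 y)| ≤ 2 * ‖y' - y‖ := by
  have := abs_radius_segment_sub_le h 1 ⟨zero_le_one, le_rfl⟩
  simpa using this

end RadiusK

/-- **Registered bookkeeping sub-goal `stub_kerrRadiusLipschitz` of the line** (brick of the landing of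
K2b-5 `stub_marchingLemma`): the Kerr–Schild radius is `2`-Lipschitz on short slice segments (anchor of
this file, `RadiusK.abs_radius_sub_le`). [cite: DafermosRodnianski2008, §5.1] -/
theorem stub_kerrRadiusLipschitz : ∀ (a : ℝ) (y y' : E3),
    2 * ‖y' - y‖ < Kerr.radius a (E4.ofTimeSpace 0 y) - |a| →
    |Kerr.radius a (E4.ofTimeSpace 0 y') - Kerr.radius a (E4.ofTimeSpace 0 y)| ≤ 2 * ‖y' - y‖ :=
  fun _ _ _ h => RadiusK.abs_radius_sub_le h

end Summit.FinalStateConjecture.FinalStateConjecture.Theorems.BondiBartnikRigidity.DirectMethod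

end
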